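import Summits.QuantumFields.YangMills.Theorems.BalabanUVNodesN07TildeTowerLettersAtDatum
import HarnessLib

/-!
# DAG node N07 [B11] — THE □̃-TOWER LETTERS AT A BOX-FORM DATUM: the widened fine □̃ placed from the PRINT BOX (dag-n07-e's meeting antecedent of record), (145)∕(151) on the WHOLE
# □̃-tower from fine regularity, and the radial shear gauge `uL` of ANY configuration with its □̃-tower and canonical-box rows (the data-lane objects of the S6 head's `HCHART` and of
# dag-n07-w8's (r2) door), generic in the datum — FILE 1 of 2 (FILE 2 `…N07TildeTowerLettersAtToken` instantiates at the token's binders)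

Cell `pub-ymgap` (HUMAN RULINGS D-0062 ∕ D-0088 ∕ D-0149), width seat `pub-ymgap-dag-n07-w6` (second wave), harness re-seat g3, 2026-08-28; CLAIM-1 ∕ INTENT-1 (cell bus I.40165; DECL-DELTA:
split in two modules under the 400-line cap).  `--kind proof --supports stmt-QuantumFields-27364 --as helper` (K1⁹ per dag-lead KEY MAP v2; count-neutral).  THEOREMS ONLY.

THE POINT.  The S6 head's knit of record (dag-n07-w4 g4 FILE 7 `…N07SplitClauseHeadKnitRanged`, p642949) owes `HCHART` at CLEAN datums of the token, read with the BOX-FORM meeting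
antecedent `∃ x ∈ box L (cornerP Mc ρ idx) (sideP Mc ρ) j, ∃ y, π y ∈ Ω_j ∧ Within 3 x y` (dag-n07-e's located binder of record); its data-lane rows `hv` read `dist1 (M^{j'}((U₁)^{uL}) c)
≤ v ε δ j j'` on p627154's canonical boxes, `uL` ∃-chosen.  dag-n07-w8 g6's (r2) door (FILE 18 `…N07ShearLetterOfFine`, p642925) displays the binders `h52` (fine regularity of `U` on
the widened fine □̃), the radial tower `hax` of `(U^{u})^{uL}` and its top row `htop` on `□̃^{(k)}`.  This base's p642198 placed the widened □̃ from the GRID CUBE; p640582 gave the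
canonical-box rows.  THIS FILE (generic datum `(a, M, ρ, k)`): §1 re-keys the placement on the PRINT BOX; §2 runs p640582's capstone on the WHOLE □̃-tower (so the top box is served)
and packages, for ANY configuration `V`, ONE gauge `uL := mulG h̄ w` with the radial tower, the □̃-tower rows and the canonical-box rows — the ladder explicit and AFFINE in `α₀`.

WHAT THIS FILE DOES (integer box bookkeeping + by-name composition; NOTHING of [B11]∕[6]∕[B7]∕[III] analysis asserted).
* §1 ★ `within_of_mem_box_of_mem_tildeTowerWide_zero` (a point of the print box is within `Lⁿ·E₁` of every label of the widened fine □̃, `E₁ = Mc + 11d + 4ρ + 2(L+R)`),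
  `cover_mem_Ω_pred_of_mem_box_…` (`n ≥ 2`), `cover_mem_hullD_of_mem_box_…` (`n = 1`), ★★ `mem_omegaPlaqsTop_pred_of_mem_box_of_mem_tildeTowerWide_zero` (both; single floor `L·E₁ + Dw ≤ M₁`).
* §2 ★★★ `dist1_iter_le_down_the_radialRep_tildeTower_of_fine` — p640582's ★★★ RUN ON THE WHOLE □̃-TOWER `[tlo L (tLo a ρ)(k−j), thi L (tHi a M ρ)(k−j)]` (FILE 9
  `dist1_iter_le_down_the_radialRep_blowDown` + FILE-1(g2) `ladder_of_sum` + p640582 §1–§3 BY NAME); ★★★ `exists_shearGauge_radialRep_rows_of_fine` — for ANY `V`: `∃ uL`, (i) radial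
  tower of `V^{uL}` below `k`, (ii) the □̃-tower rows, (iii) the canonical-box rows (FILE 4 `exists_residual_radialTower_record` + `radialTower_gaugeAct_blockLift`, `gaugeAct_gaugeAct`).

HONEST FRAMING (binding).  Count-neutral helper; by-name composition of LANDED theorems (this base p642198 · p640582 · p639087 · p629557 · p634454; node00 `cover_mem_of_within_of_seqSeparated`
∕ `cover_mem_hullD_one_of_within`) + label arithmetic; fine regularity near □̃, its ranges, non-wrapping, the meet and the floor are HYPOTHESES ∕ the consumer's; the `av`-rows of `HCHART`
(Landau copy) are NOT here; nothing of [B11]∕[6]∕[B7]∕[III] analysis asserted; `HCHART` NOT discharged; `stub_prop8StepCoPG13` ∕ K0⁷ ∕ K1⁹ NOT closed; N07 NOT discharged; the chair's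
tally of record is the only count; **no summit statement is proved by this seat** — one finite `T⁴` programme at fixed `ε`, Bałaban AS PRINTED; the route closes the conditional
finite-𝕋⁴ rung `BalabanLadder.UV` only; NOT continuum ∕ ℝ⁴ ∕ OS ∕ mass gap ∕ Clay.  No `sorry`, no `def`, no `instance`, no `notation`.

RELATED IN THE TREE, NOT DUPLICATED: p642198 `…N07TildeTowerLettersAtDatum` (grid-cube meet; its §2 proofs followed line by line here on the box), p640582 (CONSUMED), dag-n07-w8 g6
`…N07ShearLetterOfFine` ∕ `…AtDatum` (the (r2) door — CONSUMER of §2's outputs, not restated).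

References: [B11] = [Balaban1985Variational] (17) p. 279, (144) p. 300, (145)–(147), (151) p. 301; [6] = [Balaban1985RegularSpaces] (1.3)–(1.7) p. 77, (1.14)–(1.15) p. 78, Lemma 1
(1.25) p. 79, p. 98; [B7] = [Balaban1985Averaging] Prop. 2 (52)–(53) p. 26; [III] = [Balaban1988Convergent] p. 255, (2.13) p. 256.
-/

noncomputable section

namespace Summit.QuantumFields.YangMills.BalabanUVNodes.N07TildeTowerLettersBoxDatum

open scoped Matrix.Norms.L2Operator BigOperators
open Literature.MathematicalPhysics.QuantumFieldTheory.Balaban1983to89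
open Literature.MathematicalPhysics.QuantumFieldTheory.Balaban1983to89.Node00
open T4Continuum
open T4AxialGaugeSmallField (castSite castSite_apply axialGauge boxPlaqs)
open B15Eq177GaugeInvariance (blockLift)
open B15Eq112TorusCover (cover)
open B14DomainGeom (Pt Within)
open B14.Eq213MaximalDomains (side cubeExt)
open GaugeField (gaugeAct)
open ExpMeanLog (deltaSU deltaSU_pos)
open B8Eq131Cubes (gs sqLo sqHi tLo tHi box bLo bHi margin_own)
open B8Ineq130 (tlo thi tlo_apply thi_apply)
open Summit.QuantumFields.Balaban3D.Carriers (radialContourData)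
open Summit.QuantumFields.YangMills.BalabanUVNodes.N07DataDownTheTowerBlowDown (dist1_plaqHol_iter_gaugeAct)
open Summit.QuantumFields.YangMills.BalabanUVNodes.N07DataDownTheRadialTower (dist1_iter_le_down_the_radialRep_blowDown)
open Summit.QuantumFields.YangMills.BalabanUVNodes.N07DataDownTheTowerLevelBoxes (tildeTower_lo_step tildeTower_hi_step tHi_le_tLo_add ladder_of_sum)
open Summit.QuantumFields.YangMills.BalabanUVNodes.N07TildeTowerLettersFromFine (dist1_iter_le_down_the_radialRep_levelBoxes_of_fine plaqSmallOn_tildeTowerWide_of_fine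
  smallness_ht_of_alpha exists_label_near_of_block_position mem_tildeTowerWide_of_blockOf_mem boxPlaqs_tilde_subset_tildeTowerWide)
open Summit.QuantumFields.YangMills.BalabanUVNodes.N07TildeTowerLettersAtDatum (plaqSmallOn_gaugeAct_iff)
open Summit.QuantumFields.YangMills.BalabanUVNodes.N07RadialAxialTower (exists_residual_radialTower_record radialTower_gaugeAct_blockLift)

/-! ## §1  Box-keyed placement of the widened fine □̃ (the meet on the PRINT BOX) -/

section Geometry

variable {P : Params}

/-- ★ **A POINT OF THE PRINT BOX IS WITHIN `Lⁿ·E₁` OF EVERY LABEL OF THE WIDENED FINE □̃**, `E₁ := Mc + 11d + 4ρ + 2(L + R)`: the print box is `[Lⁿa, Lⁿ(a + M) − 1]ᵈ`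
(`a = cornerP Mc ρ idx`, `M = sideP Mc ρ ≤ Mc + 11d + 2ρ`), the □̃ collar is `2ρ`, the widening `(L+R)·gs L n ≤ 2(L+R)Lⁿ` — p642198's `within_of_mem_tildeTowerWide_zero` keyed on the
box instead of the grid cube. [cite: Balaban1985Variational, (144) p.300; Balaban1985RegularSpaces, p.98] -/
theorem within_of_mem_box_of_mem_tildeTowerWide_zero {Mc ρ R n : ℕ} {idx x z : Pt P.d} (hx : x ∈ box P.L (cornerP P Mc ρ idx) (sideP P Mc ρ) n)
    (hz : ∀ κ, tlo P.L (tLo (cornerP P Mc ρ idx) ρ) n κ - (((P.L + R) * gs P.L n : ℕ) : ℤ) ≤ z κ ∧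
      z κ ≤ thi P.L (tHi (cornerP P Mc ρ idx) (sideP P Mc ρ) ρ) n κ + (((P.L + R) * gs P.L n : ℕ) : ℤ)) :
    Within (((P.L ^ n * (Mc + 11 * P.d + 4 * ρ + 2 * (P.L + R)) : ℕ) : ℤ)) z x := by
  have hL2 : 2 ≤ P.L := by have := P.hL.2; omega
  have hL0 : (0 : ℤ) ≤ (P.L : ℤ) ^ n := by positivity
  intro i
  obtain ⟨hx1, hx2⟩ := hx i
  obtain ⟨hz1, hz2⟩ := hz i
  simp only [bLo, bHi, Nat.cast_zero, sub_zero, add_zero] at hx1 hx2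
  rw [tlo_apply] at hz1
  rw [thi_apply] at hz2
  simp only [tLo, tHi] at hz1 hz2
  have hS : ((sideP P Mc ρ : ℕ) : ℤ) ≤ ((Mc + 11 * P.d + 2 * ρ : ℕ) : ℤ) := by exact_mod_cast sideP_le (P := P) Mc ρ
  have hm : (((P.L + R) * gs P.L n : ℕ) : ℤ) ≤ ((P.L ^ n * (2 * (P.L + R)) : ℕ) : ℤ) := by exact_mod_cast margin_own hL2 n
  push_cast at hS hm hz1 hz2 hx1 hx2 ⊢
  have p3 : (P.L : ℤ) ^ n * ((sideP P Mc ρ : ℕ) : ℤ) ≤ (P.L : ℤ) ^ n * ((Mc : ℤ) + 11 * (P.d : ℤ) + 2 * (ρ : ℤ)) := mul_le_mul_of_nonneg_left hS hL0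
  rw [abs_le]
  constructor <;> nlinarith [p3, hL0, hm, hz1, hz2, hx1, hx2]

end Geometry

section Placement

variable {P : Params} {D : ℕ → Set (Set (Site P 0))} {k : ℕ}

/-- ★ **[B11] p. 300 «`□̃ ⊂ 𝔅_{j−1}`», WIDENED, AT A BOX-FORM DATUM OF LEVEL `2 ≤ n ≤ k`**: separated sequence, a point of the PRINT BOX within `Dw` of a lift of a site of `Ω_n`, floor
`E₁ + Dw ≤ M₁` ⇒ every label of the widened fine □̃ projects into `Ω_{n−1}`. [cite: Balaban1985Variational, (144) p.300; Balaban1985RegularSpaces, (1.3)–(1.6) p.77, p.98; Balaban1988Convergent, (2.13) p.256] -/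
theorem cover_mem_Ω_pred_of_mem_box_of_mem_tildeTowerWide_zero {M₁ : ℕ} (hM₁ : 1 ≤ M₁) (s : B14.Eq218Concrete.Seq D k) (hsep : Sect2.SeqSeparated M₁ s)
    {Mc ρ R Dw : ℕ} (hfloor : Mc + 11 * P.d + 4 * ρ + 2 * (P.L + R) + Dw ≤ M₁) {n : ℕ} (hn : 2 ≤ n) (hnk : n ≤ k)
    {idx x y : Pt P.d} (hx : x ∈ box P.L (cornerP P Mc ρ idx) (sideP P Mc ρ) n) (hy : cover P y ∈ s.Ω n) (hxy : Within (Dw : ℤ) x y) {z : Pt P.d}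
    (hz : ∀ κ, tlo P.L (tLo (cornerP P Mc ρ idx) ρ) n κ - (((P.L + R) * gs P.L n : ℕ) : ℤ) ≤ z κ ∧
      z κ ≤ thi P.L (tHi (cornerP P Mc ρ idx) (sideP P Mc ρ) ρ) n κ + (((P.L + R) * gs P.L n : ℕ) : ℤ)) :
    cover P z ∈ s.Ω (n - 1) := by
  have hw := (within_of_mem_box_of_mem_tildeTowerWide_zero hx hz).triangle hxy
  obtain ⟨m, rfl⟩ : ∃ m, n = m + 1 := ⟨n - 1, by omega⟩
  rw [Nat.add_sub_cancel]
  refine cover_mem_of_within_of_seqSeparated hM₁ s hsep (by omega) (by omega) hy (hw.mono ?_)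
  rw [side]
  have hL : (1 : ℤ) ≤ (P.L : ℤ) ^ (m + 1) := by exact_mod_cast Nat.one_le_pow _ _ P.L_pos
  have hf : ((Mc + 11 * P.d + 4 * ρ + 2 * (P.L + R) + Dw : ℕ) : ℤ) ≤ M₁ := by exact_mod_cast hfloor
  push_cast at hf ⊢
  nlinarith

/-- ★ **AT LEVEL `n = 1` THE WIDENED FINE □̃ OF A BOX-FORM DATUM PROJECTS INTO THE SUPPORT** `hullD P M₁ 1 (Ω 1)` ([III] p. 255), floor `L·E₁ + Dw ≤ M₁`.
[cite: Balaban1988Convergent, p.255, (2.13) p.256; Balaban1985Variational, (144) p.300; Balaban1985RegularSpaces, p.98] -/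
theorem cover_mem_hullD_of_mem_box_of_mem_tildeTowerWide_zero {M₁ : ℕ} (hM₁ : 1 ≤ M₁) {Ω : ℕ → Set (Site P 0)}
    {Mc ρ R Dw : ℕ} (hfloor : P.L * (Mc + 11 * P.d + 4 * ρ + 2 * (P.L + R)) + Dw ≤ M₁)
    {idx x y : Pt P.d} (hx : x ∈ box P.L (cornerP P Mc ρ idx) (sideP P Mc ρ) 1) (hy : cover P y ∈ Ω 1) (hxy : Within (Dw : ℤ) x y) {z : Pt P.d}
    (hz : ∀ κ, tlo P.L (tLo (cornerP P Mc ρ idx) ρ) 1 κ - (((P.L + R) * gs P.L 1 : ℕ) : ℤ) ≤ z κ ∧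
      z κ ≤ thi P.L (tHi (cornerP P Mc ρ idx) (sideP P Mc ρ) ρ) 1 κ + (((P.L + R) * gs P.L 1 : ℕ) : ℤ)) :
    cover P z ∈ hullD P M₁ 1 (Ω 1) := by
  have hw := (within_of_mem_box_of_mem_tildeTowerWide_zero hx hz).triangle hxy
  refine cover_mem_hullD_one_of_within (by omega) hy (hw.mono ?_)
  have hf : ((P.L * (Mc + 11 * P.d + 4 * ρ + 2 * (P.L + R)) + Dw : ℕ) : ℤ) ≤ M₁ := by exact_mod_cast hfloor
  push_cast at hf ⊢
  nlinarith

/-- ★★ **THE WIDENED FINE □̃ OF A BOX-FORM DATUM LIES IN THE (17)-REGION ONE LEVEL DOWN** — both cases, single floor `L·E₁ + Dw ≤ M₁`: every fine plaquette based at a label of the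
widened fine □̃ of a datum of level `1 ≤ n ≤ k` whose PRINT BOX comes within `Dw` of `Ω_n` belongs to `Sect2.omegaPlaqsTop s.Ω (hullD P M₁ 1 (s.Ω 1)) (n − 1)` — the set the token's
(17) clause reads at level `n − 1` (`suppDomOfRecord = hullD … ν.M₁ 1 (Ω 1)`, rfl). p642198 §2's ★★ re-keyed on dag-n07-e's box-form meeting antecedent of record.
[cite: Balaban1985Variational, (144) p.300, (17) p.279; Balaban1985RegularSpaces, (1.7) p.77, p.98; Balaban1988Convergent, p.255, (2.13) p.256] -/
theorem mem_omegaPlaqsTop_pred_of_mem_box_of_mem_tildeTowerWide_zero {M₁ : ℕ} (hM₁ : 1 ≤ M₁) (s : B14.Eq218Concrete.Seq D k) (hsep : Sect2.SeqSeparated M₁ s)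
    {Mc ρ R Dw : ℕ} (hfloor : P.L * (Mc + 11 * P.d + 4 * ρ + 2 * (P.L + R)) + Dw ≤ M₁) {n : ℕ} (hn : 1 ≤ n) (hnk : n ≤ k)
    {idx x y : Pt P.d} (hx : x ∈ box P.L (cornerP P Mc ρ idx) (sideP P Mc ρ) n) (hy : cover P y ∈ s.Ω n) (hxy : Within (Dw : ℤ) x y)
    {q : Plaq P 0} {z : Pt P.d}
    (hz : ∀ κ, tlo P.L (tLo (cornerP P Mc ρ idx) ρ) n κ - (((P.L + R) * gs P.L n : ℕ) : ℤ) ≤ z κ ∧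
      z κ ≤ thi P.L (tHi (cornerP P Mc ρ idx) (sideP P Mc ρ) ρ) n κ + (((P.L + R) * gs P.L n : ℕ) : ℤ))
    (hq : q.src = castSite z) :
    q ∈ Sect2.omegaPlaqsTop s.Ω (hullD P M₁ 1 (s.Ω 1)) (n - 1) := by
  unfold Sect2.omegaPlaqsTop
  rw [B8Eq17ClassAkV1.mem_plaqsOf]
  refine Or.inl ?_
  rw [hq]
  rcases Nat.eq_or_lt_of_le hn with h1 | h1
  · subst h1
    rw [if_pos rfl]
    exact cover_mem_hullD_of_mem_box_of_mem_tildeTowerWide_zero hM₁ hfloor hx hy hxy hz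
  · rw [if_neg (by omega)]
    refine cover_mem_Ω_pred_of_mem_box_of_mem_tildeTowerWide_zero hM₁ s hsep ?_ (by omega) hnk hx hy hxy hz
    have : Mc + 11 * P.d + 4 * ρ + 2 * (P.L + R) ≤ P.L * (Mc + 11 * P.d + 4 * ρ + 2 * (P.L + R)) := Nat.le_mul_of_pos_left _ P.L_pos
    omega

end Placement

/-! ## §2  The □̃-tower rows from fine regularity, and the radial shear gauge -/

section Fine

variable {F : T4Continuum.T4Family} {N : ℕ} [NeZero N] {K : ℕ}

/-- ★★★ **(145)∕(151) ON THE WHOLE □̃-TOWER WITH ONLY FINE REGULARITY DISPLAYED** (p640582's canonical-box capstone run on `[tlo L (tLo a ρ)(k−j), thi L (tHi a M ρ)(k−j)]` itself, so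
that the TOP box `□̃^{(k)}` is served): `U′` carries the radial tower below `k` (`k ≤ m + K`); its fine plaquettes based at labels of the widened fine □̃ are `< α₀η_k²` with `α₀` in
dag-n11-d's range; `1 ≤ M`, non-wrapping `M + 4ρ < sitesPerDir k`.  Then at `U″ := U′^{h̄}`, `h := axialGauge (M^k U′) (tLo a ρ) (tHi a M ρ)`, every level-`j` bond `c` of the □̃-tower box
obeys `dist1 (M^j U″ c) ≤ (d−1)(M+4ρ−1)·2α₀ + C′·Σ_{i∈[j,k)} 2α₀(Lⁱη_k)²`; at `j = k` the sum is empty (the top letter of dag-n07-w8's `htop`).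
[cite: Balaban1985Variational, (144) p.300, (145)–(147) p.301, (151) p.301; Balaban1985Averaging, Prop. 2 (52)–(53) p.26; Balaban1985RegularSpaces, p.98, (1.15) p.78, Lemma 1 (1.25) p.79] -/
theorem dist1_iter_le_down_the_radialRep_tildeTower_of_fine {k : ℕ} (hk : k ≤ (F.P K).m + (F.P K).K) (U' : GaugeField (F.P K) 0 (SU N))
    (hax : ∀ i < k, AxialGauge (radialContourData (F.P K) i (SU N)) (Averaging.iter (avOfRecord F N K) i U'))
    (a₀ : Fin (F.P K).d → ℤ) {M ρ : ℕ} (hM : 1 ≤ M) (hwrap : M + 4 * ρ < (F.P K).sitesPerDir k)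
    {α₀ : ℝ} (hα : 0 < α₀) (hα3 : (143 * (((((F.P K).d + 4 : ℕ) : ℝ)) ^ 2 / 4) ^ 2) * α₀ ≤ 1 / 3)
    (hα2 : 2 * α₀ ≤ 2 * deltaSU (Fin N) / ((((F.P K).d + 4) * (F.P K).L : ℕ) : ℝ) ^ 2)
    (h52 : PlaqSmallOn {q : Plaq (F.P K) 0 | ∃ x : Fin (F.P K).d → ℤ,
        (∀ κ, tlo (F.P K).L (tLo a₀ ρ) k κ - ((((F.P K).L + (((F.P K).d + 4) * (F.P K).L + 2)) * gs (F.P K).L k : ℕ) : ℤ) ≤ x κ ∧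
          x κ ≤ thi (F.P K).L (tHi a₀ M ρ) k κ + ((((F.P K).L + (((F.P K).d + 4) * (F.P K).L + 2)) * gs (F.P K).L k : ℕ) : ℤ)) ∧ q.src = castSite x}
      (α₀ * (F.P K).eta k ^ 2) U') :
    ∀ j ≤ k, ∀ c : PBond (F.P K) j,
      c.src ∈ (castSite '' Set.Icc (tlo (F.P K).L (tLo a₀ ρ) (k - j)) (thi (F.P K).L (tHi a₀ M ρ) (k - j)) : Set (Site (F.P K) j)) →
      c.tgt ∈ (castSite '' Set.Icc (tlo (F.P K).L (tLo a₀ ρ) (k - j)) (thi (F.P K).L (tHi a₀ M ρ) (k - j)) : Set (Site (F.P K) j)) →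
      dist1 (Averaging.iter (avOfRecord F N K) j (gaugeAct (blockLift k (axialGauge (Averaging.iter (avOfRecord F N K) k U') (tLo a₀ ρ) (tHi a₀ M ρ))) U') c) ≤
        (((F.P K).d - 1 : ℕ) : ℝ) * ((M + 4 * ρ - 1 : ℕ) : ℝ) * (2 * α₀) +
          (7 * ((((((F.P K).d + 2) * (F.P K).L : ℕ) : ℝ) ^ 2 / 4)) +
              ((((((F.P K).d + 1) * ((F.P K).L - 1) : ℕ) : ℝ)) + 1) *
                (((((F.P K).d * ((F.P K).L - 1) + 1 : ℕ) : ℝ)) * (((((F.P K).d - 1 : ℕ) : ℝ) * (((F.P K).L - 1 : ℕ) : ℝ))))) *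
            ∑ i ∈ Finset.Ico j k, 2 * α₀ * ((((F.P K).L : ℝ) ^ i * (F.P K).eta k) ^ 2) := by
  obtain ⟨hlev, htop⟩ := plaqSmallOn_tildeTowerWide_of_fine (F := F) (N := N) hk a₀ M ρ hα hα3 hα2 h52
  -- the □̃-tower is an exact blow-down tower with top box `[tLo, tHi]` of width `M + 4ρ − 1`
  have hn : ∀ κ, (fun j => thi (F.P K).L (tHi a₀ M ρ) (k - j)) k κ ≤ (fun j => tlo (F.P K).L (tLo a₀ ρ) (k - j)) k κ + ((M + 4 * ρ - 1 : ℕ) : ℤ) := by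
    simpa only [Nat.sub_self, B8Ineq130.tlo_zero, B8Ineq130.thi_zero] using tHi_le_tLo_add a₀ ρ hM
  have hnN : (M + 4 * ρ - 1) + 1 < (F.P K).sitesPerDir k := by omega
  -- the explicit affine ladder
  have hT : (0 : ℝ) ≤ (((F.P K).d - 1 : ℕ) : ℝ) * ((M + 4 * ρ - 1 : ℕ) : ℝ) * (2 * α₀) := by positivity
  have hlad := ladder_of_sum (k := k) (fun i => 2 * α₀ * ((((F.P K).L : ℝ) ^ i * (F.P K).eta k) ^ 2)) (fun j _ => by positivity) hT
    (A := ((((F.P K).d * ((F.P K).L - 1) + 1 : ℕ) : ℝ))) (BC := (((((F.P K).d - 1 : ℕ) : ℝ) * (((F.P K).L - 1 : ℕ) : ℝ))))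
    (Q := ((((((F.P K).d + 2) * (F.P K).L : ℕ) : ℝ) ^ 2 / 4))) (E := (((((F.P K).d + 1) * ((F.P K).L - 1) : ℕ) : ℝ)))
    (by positivity) (by positivity) (by positivity) (by positivity)
  have key := dist1_iter_le_down_the_radialRep_blowDown hk U' hax (fun j => tlo (F.P K).L (tLo a₀ ρ) (k - j)) (fun j => thi (F.P K).L (tHi a₀ M ρ) (k - j))
    (fun j hj => tildeTower_lo_step (F.P K).L a₀ ρ hj) (fun j hj => tildeTower_hi_step (F.P K).L a₀ M ρ hj) hn hnN
    (by simpa only [Nat.sub_self, B8Ineq130.tlo_zero, B8Ineq130.thi_zero] using (boxPlaqs_tilde_subset_tildeTowerWide (P := F.P K) a₀ M ρ _ k))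
    htop (by positivity)
    (fun i => 2 * α₀ * ((((F.P K).L : ℝ) ^ i * (F.P K).eta k) ^ 2))
    (fun j => (((F.P K).d - 1 : ℕ) : ℝ) * ((M + 4 * ρ - 1 : ℕ) : ℝ) * (2 * α₀) +
      (7 * ((((((F.P K).d + 2) * (F.P K).L : ℕ) : ℝ) ^ 2 / 4)) +
          ((((((F.P K).d + 1) * ((F.P K).L - 1) : ℕ) : ℝ)) + 1) *
            (((((F.P K).d * ((F.P K).L - 1) + 1 : ℕ) : ℝ)) * (((((F.P K).d - 1 : ℕ) : ℝ) * (((F.P K).L - 1 : ℕ) : ℝ))))) *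
        ∑ i ∈ Finset.Ico j k, 2 * α₀ * ((((F.P K).L : ℝ) ^ i * (F.P K).eta k) ^ 2))
    (fun j _ => by positivity) (fun j hj => smallness_ht_of_alpha (F.P K) deltaSU_pos hα2 hj.le) ?_ ?_ hlad.1 hlad.2
  · simpa only [Nat.sub_self, B8Ineq130.tlo_zero, B8Ineq130.thi_zero] using key
  · -- `hplaq`: the three block positions around a bond of `□̃^{(j+1)}`
    intro j hj c hs htg q hq'
    simp only [Nat.sub_self, B8Ineq130.tlo_zero, B8Ineq130.thi_zero]
    rw [dist1_plaqHol_iter_gaugeAct (by omega)]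
    obtain ⟨z', hz', hy⟩ := exists_label_near_of_block_position c hs htg (blockOf q.src)
      (by rcases hq' with h | h | h <;> simp [h])
    exact hlev j hj.le q (mem_tildeTowerWide_of_blockOf_mem (P := F.P K) a₀ M ρ _ hk hj q
      (fun κ => by simpa only [Set.mem_Icc] using hz' κ) hy)
  · -- `hplaqB`: plaquettes based in a block of `□̃^{(j+1)}`
    intro j hj y hy q hq'
    simp only [Nat.sub_self, B8Ineq130.tlo_zero, B8Ineq130.thi_zero]
    rw [dist1_plaqHol_iter_gaugeAct (by omega)]
    obtain ⟨s, hsI, hys⟩ := hy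
    rw [Set.mem_Icc] at hsI
    exact hlev j hj.le q (mem_tildeTowerWide_of_blockOf_mem (P := F.P K) a₀ M ρ _ hk hj q (z' := s)
      (fun κ => ⟨by linarith [hsI.1 κ], by linarith [hsI.2 κ]⟩) (by rw [hq', hys]))

/-- ★★★ **THE RADIAL SHEAR GAUGE OF ANY CONFIGURATION, WITH ITS □̃-TOWER AND CANONICAL-BOX ROWS** (the data-lane objects of the S6 head's `HCHART` and of dag-n07-w8's (r2) door at a
generic datum): for ANY fine configuration `V` (the consumer's `U^{u}`), fine-regular near the widened □̃ at `α₀`, there is a gauge transformation `uL := mulG h̄ w` (`w` = FILE 4's residual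
radial-tower gauge, `h` = the top axial gauge on `□̃^{(k)}`) such that `V^{uL}` (i) carries the radial tower below `k` (FILE 4 `radialTower_gaugeAct_blockLift`), (ii) obeys the □̃-tower rows
of `dist1_iter_le_down_the_radialRep_tildeTower_of_fine`, (iii) obeys p640582's canonical-box rows (four `lo∕hi` equations) — all with the explicit ladder AFFINE in `α₀`.
[cite: Balaban1985Variational, (144)–(147) pp.300–301, (151) p.301; Balaban1985RegularSpaces, (1.14)–(1.15) p.78, p.98, Lemma 1 (1.25) p.79; Balaban1985Averaging, Prop. 2 (52)–(53) p.26] -/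
theorem exists_shearGauge_radialRep_rows_of_fine {k : ℕ} (hk1 : 1 ≤ k) (hk : k ≤ (F.P K).m + (F.P K).K) (V : GaugeField (F.P K) 0 (SU N))
    (a₀ : Fin (F.P K).d → ℤ) {M ρ : ℕ} (hM : 1 ≤ M) (hρ : 1 ≤ ρ) (hwrap : M + 4 * ρ < (F.P K).sitesPerDir k)
    {lo hi : ℕ → Fin (F.P K).d → ℤ}
    (hlo0 : lo 0 = fun i => ((F.P K).L : ℤ) * (sqLo (F.P K).L a₀ ρ k 1 i - 1))
    (hhi0 : hi 0 = fun i => ((F.P K).L : ℤ) * (sqHi (F.P K).L a₀ M ρ k 1 i + 1) + (((F.P K).L : ℤ) - 1))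
    (hloj : ∀ j, 1 ≤ j → lo j = sqLo (F.P K).L a₀ ρ k j - 1) (hhij : ∀ j, 1 ≤ j → hi j = sqHi (F.P K).L a₀ M ρ k j + 1)
    {α₀ : ℝ} (hα : 0 < α₀) (hα3 : (143 * (((((F.P K).d + 4 : ℕ) : ℝ)) ^ 2 / 4) ^ 2) * α₀ ≤ 1 / 3)
    (hα2 : 2 * α₀ ≤ 2 * deltaSU (Fin N) / ((((F.P K).d + 4) * (F.P K).L : ℕ) : ℝ) ^ 2)
    (h52 : PlaqSmallOn {q : Plaq (F.P K) 0 | ∃ x : Fin (F.P K).d → ℤ,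
        (∀ κ, tlo (F.P K).L (tLo a₀ ρ) k κ - ((((F.P K).L + (((F.P K).d + 4) * (F.P K).L + 2)) * gs (F.P K).L k : ℕ) : ℤ) ≤ x κ ∧
          x κ ≤ thi (F.P K).L (tHi a₀ M ρ) k κ + ((((F.P K).L + (((F.P K).d + 4) * (F.P K).L + 2)) * gs (F.P K).L k : ℕ) : ℤ)) ∧ q.src = castSite x}
      (α₀ * (F.P K).eta k ^ 2) V) :
    ∃ uL : GaugeTransf (F.P K) 0 (SU N),
      (∀ i < k, AxialGauge (radialContourData (F.P K) i (SU N)) (Averaging.iter (avOfRecord F N K) i (gaugeAct uL V))) ∧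
      (∀ j ≤ k, ∀ c : PBond (F.P K) j,
        c.src ∈ (castSite '' Set.Icc (tlo (F.P K).L (tLo a₀ ρ) (k - j)) (thi (F.P K).L (tHi a₀ M ρ) (k - j)) : Set (Site (F.P K) j)) →
        c.tgt ∈ (castSite '' Set.Icc (tlo (F.P K).L (tLo a₀ ρ) (k - j)) (thi (F.P K).L (tHi a₀ M ρ) (k - j)) : Set (Site (F.P K) j)) →
        dist1 (Averaging.iter (avOfRecord F N K) j (gaugeAct uL V) c) ≤
          (((F.P K).d - 1 : ℕ) : ℝ) * ((M + 4 * ρ - 1 : ℕ) : ℝ) * (2 * α₀) +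
            (7 * ((((((F.P K).d + 2) * (F.P K).L : ℕ) : ℝ) ^ 2 / 4)) +
                ((((((F.P K).d + 1) * ((F.P K).L - 1) : ℕ) : ℝ)) + 1) *
                  (((((F.P K).d * ((F.P K).L - 1) + 1 : ℕ) : ℝ)) * (((((F.P K).d - 1 : ℕ) : ℝ) * (((F.P K).L - 1 : ℕ) : ℝ))))) *
              ∑ i ∈ Finset.Ico j k, 2 * α₀ * ((((F.P K).L : ℝ) ^ i * (F.P K).eta k) ^ 2)) ∧
      (∀ j ≤ k, ∀ c : PBond (F.P K) j, c.src ∈ (castSite '' Set.Icc (lo j) (hi j) : Set (Site (F.P K) j)) →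
        c.tgt ∈ (castSite '' Set.Icc (lo j) (hi j) : Set (Site (F.P K) j)) →
        dist1 (Averaging.iter (avOfRecord F N K) j (gaugeAct uL V) c) ≤
          (((F.P K).d - 1 : ℕ) : ℝ) * ((M + 4 * ρ - 1 : ℕ) : ℝ) * (2 * α₀) +
            (7 * ((((((F.P K).d + 2) * (F.P K).L : ℕ) : ℝ) ^ 2 / 4)) +
                ((((((F.P K).d + 1) * ((F.P K).L - 1) : ℕ) : ℝ)) + 1) *
                  (((((F.P K).d * ((F.P K).L - 1) + 1 : ℕ) : ℝ)) * (((((F.P K).d - 1 : ℕ) : ℝ) * (((F.P K).L - 1 : ℕ) : ℝ))))) *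
              ∑ i ∈ Finset.Ico j k, 2 * α₀ * ((((F.P K).L : ℝ) ^ i * (F.P K).eta k) ^ 2)) := by
  -- FILE 4: a residual `w` putting the radial tower on `V^{w}` below `k`
  obtain ⟨w, -, hax⟩ := exists_residual_radialTower_record F N K hk V
  -- fine plaquette smallness is gauge-invariant
  have h52' := (plaqSmallOn_gaugeAct_iff _ _ w V).mpr h52
  refine ⟨B16Sect1Backgrounds.mulG (blockLift k (axialGauge (Averaging.iter (avOfRecord F N K) k (gaugeAct w V)) (tLo a₀ ρ) (tHi a₀ M ρ))) w, ?_, ?_, ?_⟩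
  · rw [← B16Sect1Backgrounds.gaugeAct_gaugeAct]
    exact radialTower_gaugeAct_blockLift F N K hk _ _ hax
  · rw [← B16Sect1Backgrounds.gaugeAct_gaugeAct]
    exact dist1_iter_le_down_the_radialRep_tildeTower_of_fine hk _ hax a₀ hM hwrap hα hα3 hα2 h52'
  · rw [← B16Sect1Backgrounds.gaugeAct_gaugeAct]
    exact dist1_iter_le_down_the_radialRep_levelBoxes_of_fine hk1 hk _ hax a₀ hM hρ hwrap hlo0 hhi0 hloj hhij hα hα3 hα2 h52'

end Fine

end Summit.QuantumFields.YangMills.BalabanUVNodes.N07TildeTowerLettersBoxDatum
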